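import Literature.Analysis.FluidPDE.LeiZhang2011RegularityCase1U
import Literature.Analysis.FluidPDE.PeriodicCylinderSymmetry
import Literature.Analysis.FluidPDE.PeriodicCylinderFrameInversion
import HarnessLib

/-!
# Lei–Zhang 2011, Theorem 1.4, Case 1 — with the swirl bounded only in a tube near the final time

Analysis/FluidPDE **proofs file** (theorems only: no definitions, no named facts, no `sorry`),
companion of `LeiZhang2011RegularityCase1U` on the discharge path of
`Literature.Analysis.FluidPDE.LeiZhang2011_regularity_bmoStream` (Z. Lei, Q. S. Zhang,
J. Funct. Anal. 261 (2011) = arXiv:1011.5066, Theorem 1.4, proof §4, Case 1, p. 12).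

`case1_falseLoc` is `case1_falseU` with the hypothesis `|Γ| ≤ C₁` on all of `(0, T) × ℝ³`
replaced by the bound **in a tube around the axis near the final time**,
`|Γ(t, x)| ≤ C₁` for `t ∈ (T₁, T)`, `r(x) ≤ ρ` — which is what the local maximum estimate of the
paper's §2 provides for Leray–Hopf solutions (`LeiZhang2011.abs_swirl_le_local_of_classical`),
the printed "maximum principle" (p. 12) being unavailable through singular times. The proof is
verbatim that of `case1_falseU`: the bound is consumed only in the blow-up limit, pointwise in the
rescaled variable and eventually along the sequence, and the rescaled windows eventually lie in
the tube (`c_n → 0`, `t_n → T`). [cite: LeiZhang2011, Thm. 1.4, proof §4, Case 1 (arXiv p. 12)]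

## References

* Z. Lei, Q. S. Zhang, J. Funct. Anal. 261 (2011) = arXiv:1011.5066: Thm. 1.4 proof §4 Case 1,
  §2 (2.6). [LeiZhang2011]
-/

noncomputable section

open MeasureTheory Set Function Filter Topology TopologicalSpace Metric
open scoped InnerProductSpace RealInnerProductSpace NNReal ENNReal

namespace Literature.Analysis.FluidPDE

open Literature.Analysis.FunctionSpaces SereginSverak2009

/-- **Lei–Zhang 2011, Theorem 1.4, Case 1 (`r_k Q_k` bounded) leads to a contradiction — swirl
bounded in a tube near the final time.** As `case1_falseU`, for a classical solution on
`(0, T) × ℝ³` with axisymmetric slices and a stream function with `BMO` slices, but with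
`|Γ(t, x)| ≤ C₁` assumed only for `t ∈ (T₁, T)` and `r(x) ≤ ρ` (`ρ > 0`), and with the
near-maxima satisfying in addition `t_n → T`, `M_n → ∞`.
[cite: LeiZhang2011, Thm. 1.4, proof §4, Case 1 (arXiv p. 12)] -/
theorem case1_falseLoc {T : ℝ} {u : ℝ → EuclideanSpace ℝ (Fin 3) → EuclideanSpace ℝ (Fin 3)}
    {p : ℝ → EuclideanSpace ℝ (Fin 3) → ℝ}
    (h : IsClassicalNSSolutionOn (Ioo 0 T) 1 0 u p)
    (haxi : ∀ t ∈ Ioo 0 T, IsAxisymmetric (u t))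
    {C₁ T₁ ρ : ℝ} (hT₁ : T₁ < T) (hρ : 0 < ρ)
    (hΓ : ∀ t ∈ Ioo T₁ T, ∀ x, cylRadius x ≤ ρ → |swirl (u t) x| ≤ C₁)
    {Bs : ℝ → EuclideanSpace ℝ (Fin 3) → EuclideanSpace ℝ (Fin 3)} {Kb : ℝ≥0}
    (hBs : HasBMOStreamFunctionOn (Ioo 0 T) u Bs Kb)
    (hstep : ∀ (v : ℝ → EuclideanSpace ℝ (Fin 3) → EuclideanSpace ℝ (Fin 3)) (C : ℝ)
      (K' : ℝ≥0),
      IsBoundedWeakNSSolutionOn (Iio 0) isOpen_Iio 1 v → Continuous (uncurry v) →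
      (∀ t < 0, IsAxisymmetric (v t)) → (∀ t < 0, ∀ x, |swirl (v t) x| ≤ C) →
      (∀ t < 0, ∃ Bt : EuclideanSpace ℝ (Fin 3) → EuclideanSpace ℝ (Fin 3),
        LocallyIntegrable Bt volume ∧ eBMOSeminormVec Bt ≤ K' ∧
        ∀ (φ : EuclideanSpace ℝ (Fin 3) → ℝ) (e : EuclideanSpace ℝ (Fin 3)),
          ContDiff ℝ 1 φ → HasCompactSupport φ →
            ∫ x, φ x * ⟪v t x, e⟫ = ∫ x, ⟪cross (Bt x) (gradient φ x), e⟫) →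
      ∀ t < 0, HasNoSwirl (v t))
    {tn : ℕ → ℝ} {xn : ℕ → EuclideanSpace ℝ (Fin 3)} (htn : ∀ n, tn n ∈ Ioo 0 T)
    (htnT : Tendsto tn atTop (𝓝 T))
    (hMpos : ∀ n, 0 < ‖u (tn n) (xn n)‖)
    (hMtop : Tendsto (fun n => ‖u (tn n) (xn n)‖) atTop atTop)
    (hmax : ∀ n, ∀ s ∈ Ioc 0 (tn n), ∀ y, ‖u s y‖ ≤ 2 * ‖u (tn n) (xn n)‖)
    (hA2 : ∀ n, 2 ≤ tn n * ‖u (tn n) (xn n)‖ ^ 2)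
    (hAtop : Tendsto (fun n => tn n * ‖u (tn n) (xn n)‖ ^ 2) atTop atTop)
    {D : ℝ} (hD : ∀ n, cylRadius (xn n) * ‖u (tn n) (xn n)‖ ≤ D) : False := by
  -- the uniform Lipschitz constant on unit windows at the bound `2`
  obtain ⟨K, hK0, hKprop⟩ :=
    KNSS2009_regularity_boundedWeak_window_holds.lipschitz_of_bmoStream 2
  set M : ℕ → ℝ := fun n => ‖u (tn n) (xn n)‖ with hMdef
  -- the scaling factors and the time intervals of the rescaled solutions
  set c : ℕ → ℝ := fun n => (M n)⁻¹ with hcdef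
  have hcpos : ∀ n, 0 < c n := fun n => inv_pos.2 (hMpos n)
  have hceq : ∀ n, c n = ‖u (tn n) (xn n)‖⁻¹ := fun n => rfl
  set A : ℕ → ℝ := fun n => -(tn n / c n ^ 2) with hAdef
  set B : ℕ → ℝ := fun n => (T - tn n) / c n ^ 2 with hBdef
  have hAeq : ∀ n, A n = -(tn n * M n ^ 2) := fun n => by
    simp only [hAdef, hcdef, inv_pow, div_inv_eq_mul]
  have hA2' : ∀ n, A n ≤ -2 := fun n => by rw [hAeq]; linarith [hA2 n]
  have hBpos : ∀ n, 0 < B n := fun n => div_pos (by linarith [(htn n).2]) (pow_pos (hcpos n) 2)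
  have hAtend : Tendsto A atTop atBot := by
    have : A = fun n => -(tn n * M n ^ 2) := funext hAeq
    rw [this]
    exact tendsto_neg_atTop_atBot.comp hAtop
  -- the rescaled solutions, centred on the axis
  set V : ℕ → ℝ → EuclideanSpace ℝ (Fin 3) → EuclideanSpace ℝ (Fin 3) :=
    fun n => c n • stPull (c n ^ 2) (c n) (tn n) (xn n 2 • eZ) u with hVdef
  set P : ℕ → ℝ → EuclideanSpace ℝ (Fin 3) → ℝ :=
    fun n => c n ^ 2 • stPull (c n ^ 2) (c n) (tn n) (xn n 2 • eZ) p with hPdef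
  have hVcl : ∀ n, IsClassicalNSSolutionOn (Ioo (A n) (B n)) 1 0 (V n) (P n) := fun n =>
    zoom_isClassicalNSSolutionOn h (hcpos n) (tn n) (xn n)
  have hVbd : ∀ n, ∀ s ∈ Ioc (A n) 0, ∀ y, ‖V n s y‖ ≤ 2 := fun n =>
    zoom_norm_le_two (hmax n) (hMpos n) (hceq n)
  have hVmem : ∀ n, ∀ s ∈ Ioo (A n) (B n), tn n + c n ^ 2 * s ∈ Ioo 0 T := fun n s hs =>
    zoom_time_mem (hcpos n).ne' hs
  have hVaxi : ∀ n, ∀ s ∈ Ioo (A n) (B n), IsAxisymmetric (V n s) := fun n s hs =>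
    zoom_isAxisymmetric haxi (hVmem n s hs)
  -- the swirl bound survives on the windows whose physical points lie in the tube `r ≤ ρ` and
  -- whose physical times lie in `(T₁, T)`
  have hVswirl : ∀ n s (y : EuclideanSpace ℝ (Fin 3)), tn n + c n ^ 2 * s ∈ Ioo T₁ T →
      c n * ‖y‖ ≤ ρ → |swirl (V n s) y| ≤ C₁ := fun n s y hsT hy => by
    have e : V n s = fun y => c n • u (tn n + c n ^ 2 * s) (xn n 2 • eZ + c n • y) := by
      funext y; rfl
    rw [e, swirl_smul_comp_eZ_smul (u (tn n + c n ^ 2 * s)) (c n) (xn n 2) (hcpos n).ne',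
      div_self (hcpos n).ne', one_mul]
    refine hΓ _ hsT _ ?_
    calc cylRadius (xn n 2 • eZ + c n • y) = cylRadius (c n • y + xn n 2 • eZ) := by rw [add_comm]
      _ = cylRadius (c n • y) := PeriodicCylinder.cylRadius_add_smul_eZ _ _
      _ = |c n| * cylRadius y := cylRadius_smul _ _
      _ ≤ c n * ‖y‖ := by
          rw [abs_of_pos (hcpos n)]
          exact mul_le_mul_of_nonneg_left (cylRadius_le_norm y) (hcpos n).le
      _ ≤ ρ := hy
  -- `c_n → 0`
  have hc0 : Tendsto c atTop (𝓝 0) := tendsto_inv_atTop_zero.comp hMtop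
  have hVstream : ∀ n, HasBMOStreamFunctionOn (Ioo (A n) (B n)) (V n)
      (stPull (c n ^ 2) (c n) (tn n) (xn n 2 • eZ) Bs) Kb := fun n =>
    zoom_hasBMOStreamFunctionOn hBs (hcpos n).ne' (tn n) (xn n)
  set a : ℕ → EuclideanSpace ℝ (Fin 3) := fun n => (c n)⁻¹ • horiz (xn n) with hadef
  have hVone : ∀ n, ‖V n 0 (a n)‖ = 1 := fun n => norm_zoom_apply_zero_offset (hMpos n) (hceq n)
  have hale : ∀ n, ‖a n‖ ≤ D := fun n => by
    rw [hadef]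
    show ‖(c n)⁻¹ • horiz (xn n)‖ ≤ D
    rw [norm_inv_smul_horiz (hcpos n), hcdef, inv_inv, mul_comm]
    exact hD n
  have hVcont : ∀ n, ContinuousOn (uncurry (V n)) (Ioo (A n) (B n) ×ˢ univ) := fun n =>
    (hVcl n).smooth_velocity.continuousOn
  -- uniform Lipschitz bound on `[A n + 1, 0] × ℝ³`, and the clamped maps
  have hLip : ∀ n, ∀ s ∈ Icc (A n + 1) 0, ∀ t ∈ Icc (A n + 1) 0, ∀ x y,
      ‖V n t x - V n s y‖ ≤ max K 8 * (|t - s| + ‖x - y‖) := fun n =>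
    lipschitz_up_to_final_time_of_bmoStream hKprop (hA2' n) (hBpos n) (hVcl n) (hVbd n)
      ⟨_, Kb, hVstream n⟩
  set W : ℕ → ℝ × EuclideanSpace ℝ (Fin 3) → EuclideanSpace ℝ (Fin 3) :=
    fun n z => V n (max (A n + 1) (min z.1 0)) z.2 with hWdef
  have hK8 : 0 ≤ max K 8 := hK0.trans (le_max_left _ _)
  have hK8pos : 0 < max K 8 := lt_of_lt_of_le (by norm_num) (le_max_right _ _)
  have hWlip : ∀ n, LipschitzWith (Real.toNNReal (2 * max K 8)) (W n) := fun n =>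
    lipschitzWith_clamp hK8 (by linarith [hA2' n]) (hLip n)
  have hclamp : ∀ n (r : ℝ), max (A n + 1) (min r 0) ∈ Ioc (A n) 0 := fun n r =>
    ⟨by linarith [le_max_left (A n + 1) (min r 0)],
      max_le (by linarith [hA2' n]) (min_le_right _ _)⟩
  have hWball : ∀ n z, W n z ∈ closedBall (0 : EuclideanSpace ℝ (Fin 3)) 2 := fun n z =>
    mem_closedBall_zero_iff.2 (hVbd n _ (hclamp n z.1) z.2)
  -- extraction: pointwise convergence of the clamped maps, then of the offsets
  obtain ⟨φ, Winf, hφ, hWinflip, -, hWconv⟩ :=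
    exists_strictMono_tendsto_of_lipschitzWith W hWlip hWball
  obtain ⟨ainf, -, ψ, hψ, haconv⟩ := tendsto_subseq_of_bounded (x := a ∘ φ)
    (isBounded_closedBall (x := (0 : EuclideanSpace ℝ (Fin 3))) (r := D))
    (fun n => mem_closedBall_zero_iff.2 (hale (φ n)))
  set θ : ℕ → ℕ := φ ∘ ψ with hθdef
  have hθ : StrictMono θ := hφ.comp hψ
  have hWconvθ : ∀ z, Tendsto (fun m => W (θ m) z) atTop (𝓝 (Winf z)) := fun z =>
    (hWconv z).comp hψ.tendsto_atTop
  have haconvθ : Tendsto (fun m => a (θ m)) atTop (𝓝 ainf) := haconv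
  have hAθ : Tendsto (fun m => A (θ m)) atTop atBot := hAtend.comp hθ.tendsto_atTop
  have hevA : ∀ t : ℝ, ∀ᶠ m in atTop, A (θ m) + 1 ≤ t := fun t =>
    (hAθ.eventually (eventually_le_atBot (t - 1))).mono fun m hm => by linarith
  -- the limit field
  set v : ℝ → EuclideanSpace ℝ (Fin 3) → EuclideanSpace ℝ (Fin 3) := fun t x => Winf (t, x)
    with hvdef
  have hvcont : Continuous (uncurry v) := hWinflip.continuous
  have hVlim : ∀ t ≤ 0, ∀ x, Tendsto (fun m => V (θ m) t x) atTop (𝓝 (v t x)) := by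
    intro t ht x
    refine (hWconvθ (t, x)).congr' ((hevA t).mono fun m hm => ?_)
    show V (θ m) (max (A (θ m) + 1) (min t 0)) x = V (θ m) t x
    rw [min_eq_left ht, max_eq_right hm]
  have hevmem : ∀ t < 0, ∀ᶠ m in atTop, t ∈ Ioo (A (θ m)) (B (θ m)) := fun t ht =>
    (hevA t).mono fun m hm => ⟨by linarith, ht.trans (hBpos _)⟩
  -- the limit is a bounded weak solution on `(-∞, 0)`
  have hweak : IsBoundedWeakNSSolutionOn (Iio 0) isOpen_Iio 1 v := by
    refine isBoundedWeakNSSolutionOn_of_tendsto (A := fun m => A (θ m)) (V := fun m => V (θ m))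
      (M := 2) hAθ (fun m => ?_) (fun m => ?_) (fun m s hs y => hVbd (θ m) s ⟨hs.1, hs.2.le⟩ y)
      hvcont (fun t ht x => hVlim t ht.le x)
    · have hcl : IsClassicalNSSolutionOn (Ioo (A (θ m)) 0) 1 0 (V (θ m)) (P (θ m)) :=
        (hVcl (θ m)).mono (Ioo_subset_Ioo_right (hBpos _).le) (uniqueDiffOn_Ioo _ _)
      exact hcl.isBoundedWeakNSSolutionOn ⟨2, fun s hs y => hVbd (θ m) s ⟨hs.1, hs.2.le⟩ y⟩
    · exact (hVcont (θ m)).mono (prod_mono (Ioo_subset_Ioo_right (hBpos _).le) Subset.rfl)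
  -- axisymmetry and the swirl bound pass to the limit
  have hvaxi : ∀ t < 0, IsAxisymmetric (v t) := by
    intro t ht θ' y
    have h1 : Tendsto (fun m => V (θ m) t (rotZ θ' y)) atTop (𝓝 (v t (rotZ θ' y))) :=
      hVlim t ht.le _
    have h2 : Tendsto (fun m => rotZ θ' (V (θ m) t y)) atTop (𝓝 (rotZ θ' (v t y))) :=
      ((rotZL θ').continuous.tendsto _).comp (hVlim t ht.le y)
    have heq : (fun m => rotZ θ' (V (θ m) t y)) =ᶠ[atTop] fun m => V (θ m) t (rotZ θ' y) :=
      (hevmem t ht).mono fun m hm => (hVaxi (θ m) t hm θ' y).symm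
    exact tendsto_nhds_unique h1 (h2.congr' heq)
  have hvswirl : ∀ t < 0, ∀ y, |swirl (v t) y| ≤ C₁ := by
    intro t ht y
    have hsw : Tendsto (fun m => swirl (V (θ m) t) y) atTop (𝓝 (swirl (v t) y)) := by
      have h0 : Tendsto (fun m => V (θ m) t y 0) atTop (𝓝 (v t y 0)) :=
        ((PiLp.continuous_apply 2 _ 0).tendsto _).comp (hVlim t ht.le y)
      have h1 : Tendsto (fun m => V (θ m) t y 1) atTop (𝓝 (v t y 1)) :=
        ((PiLp.continuous_apply 2 _ 1).tendsto _).comp (hVlim t ht.le y)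
      exact (h1.const_mul (y 0)).sub (h0.const_mul (y 1))
    -- eventually the window point is in the tube and the physical time in `(T₁, T)`
    have hθtop : Tendsto θ atTop atTop := hθ.tendsto_atTop
    have hcθ : Tendsto (fun m => c (θ m)) atTop (𝓝 0) := hc0.comp hθtop
    have htθ : Tendsto (fun m => tn (θ m) + c (θ m) ^ 2 * t) atTop (𝓝 T) := by
      have h1 : Tendsto (fun m => tn (θ m)) atTop (𝓝 T) := htnT.comp hθtop
      have h2 : Tendsto (fun m => c (θ m) ^ 2 * t) atTop (𝓝 (0 ^ 2 * t)) :=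
        (hcθ.pow 2).mul_const t
      simpa using h1.add h2
    have hev1 : ∀ᶠ m in atTop, tn (θ m) + c (θ m) ^ 2 * t ∈ Ioo T₁ T := by
      have hlt : ∀ m, tn (θ m) + c (θ m) ^ 2 * t < T := fun m => by
        have : c (θ m) ^ 2 * t < 0 := mul_neg_of_pos_of_neg (pow_pos (hcpos _) 2) ht
        linarith [(htn (θ m)).2]
      have hgt : ∀ᶠ m in atTop, T₁ < tn (θ m) + c (θ m) ^ 2 * t :=
        htθ.eventually (lt_mem_nhds hT₁)
      exact hgt.mono fun m hm => ⟨hm, hlt m⟩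
    have hev2 : ∀ᶠ m in atTop, c (θ m) * ‖y‖ ≤ ρ := by
      have h1 : Tendsto (fun m => c (θ m) * ‖y‖) atTop (𝓝 (0 * ‖y‖)) := hcθ.mul_const _
      rw [zero_mul] at h1
      exact h1.eventually (ge_mem_nhds hρ)
    exact le_of_tendsto hsw.abs ((hev1.and hev2).mono fun m hm => hVswirl (θ m) t y hm.1 hm.2)
  -- the limit has a distributional `BMO` stream function at every `t < 0`
  have hvstream : ∀ t < 0, ∃ Bt : EuclideanSpace ℝ (Fin 3) → EuclideanSpace ℝ (Fin 3),
      LocallyIntegrable Bt volume ∧ eBMOSeminormVec Bt ≤ ((6 * Kb : ℝ≥0) : ℝ≥0∞) ∧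
      ∀ (φ' : EuclideanSpace ℝ (Fin 3) → ℝ) (e : EuclideanSpace ℝ (Fin 3)),
        ContDiff ℝ 1 φ' → HasCompactSupport φ' →
          ∫ x, φ' x * ⟪v t x, e⟫ = ∫ x, ⟪cross (Bt x) (gradient φ' x), e⟫ := by
    intro t ht
    obtain ⟨k₀, hk₀⟩ := eventually_atTop.1 ((hevmem t ht).and (hevA t))
    -- the shifted sequence
    set w : ℕ → EuclideanSpace ℝ (Fin 3) → EuclideanSpace ℝ (Fin 3) :=
      fun k => V (θ (k + k₀)) t with hw
    set Bk : ℕ → EuclideanSpace ℝ (Fin 3) → EuclideanSpace ℝ (Fin 3) :=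
      fun k => stPull (c (θ (k + k₀)) ^ 2) (c (θ (k + k₀))) (tn (θ (k + k₀)))
        (xn (θ (k + k₀)) 2 • eZ) Bs t with hBk
    have hmem : ∀ k, t ∈ Ioo (A (θ (k + k₀))) (B (θ (k + k₀))) := fun k =>
      (hk₀ (k + k₀) (by omega)).1
    have hAk : ∀ k, A (θ (k + k₀)) + 1 ≤ t := fun k => (hk₀ (k + k₀) (by omega)).2
    have hstr : ∀ k, Differentiable ℝ (Bk k) ∧ curl (Bk k) =ᵐ[volume] w k ∧
        eBMOSeminormVec (Bk k) ≤ Kb := fun k => hVstream (θ (k + k₀)) t (hmem k)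
    have hwc : ∀ k, Continuous (w k) := fun k =>
      (hVcont (θ (k + k₀))).comp_continuous (Continuous.prodMk_right t)
        fun x => ⟨hmem k, mem_univ x⟩
    have hconvpt : ∀ x, Tendsto (fun k => w k x) atTop (𝓝 (v t x)) := fun x =>
      (hVlim t ht.le x).comp (tendsto_add_atTop_nat k₀)
    have hlipx : ∀ k x y, ‖w k x - w k y‖ ≤ max K 8 * ‖x - y‖ := fun k x y => by
      have := hLip (θ (k + k₀)) t ⟨hAk k, ht.le⟩ t ⟨hAk k, ht.le⟩ x y
      simpa using this
    have hunif := (tendstoLocallyUniformly_of_lipschitz_of_tendsto hK8pos hlipx hconvpt).2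
    obtain ⟨Bu, hBui, hBubmo, hid⟩ := exists_bmoStream_of_tendstoUniformlyOn
      (fun k => (hstr k).1) (fun k => (hstr k).2.1) (fun k => (hstr k).2.2)
      (fun k => (hwc k).locallyIntegrable)
      ((hvcont.comp (Continuous.prodMk_right t)).locallyIntegrable) (fun r _ => hunif r)
    exact ⟨Bu, hBui, hBubmo.trans_eq (by push_cast; rfl), hid⟩
  -- the swirl step, and Case 1 for the limit
  have hnoswirl := hstep v C₁ (6 * Kb) hweak hvcont hvaxi hvswirl hvstream
  have hvstream' : ∀ t < 0, ∃ Bt : EuclideanSpace ℝ (Fin 3) → EuclideanSpace ℝ (Fin 3),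
      LocallyIntegrable Bt volume ∧ eBMOSeminormVec Bt < ∞ ∧
      ∀ (φ' : EuclideanSpace ℝ (Fin 3) → ℝ) (e : EuclideanSpace ℝ (Fin 3)),
        ContDiff ℝ 1 φ' → HasCompactSupport φ' →
          ∫ x, φ' x * ⟪v t x, e⟫ = ∫ x, ⟪cross (Bt x) (gradient φ' x), e⟫ := fun t ht =>
    (hvstream t ht).imp fun Bt h => ⟨h.1, h.2.1.trans_lt ENNReal.coe_lt_top, h.2.2⟩
  have hv0 := case1_limit_eq_zero_of_hasNoSwirl hweak hvcont hvaxi hnoswirl hvstream'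
  -- but `‖v(0, a)‖ = lim ‖V_n(0, a_n)‖ = 1`
  have hWa : Tendsto (fun m => W (θ m) (0, a (θ m))) atTop (𝓝 (Winf (0, ainf))) := by
    rw [tendsto_iff_dist_tendsto_zero]
    have h1 : ∀ m, dist (W (θ m) (0, a (θ m))) (Winf (0, ainf)) ≤
        2 * max K 8 * dist (a (θ m)) ainf + dist (W (θ m) (0, ainf)) (Winf (0, ainf)) := by
      intro m
      have hd : dist (W (θ m) (0, a (θ m))) (W (θ m) (0, ainf)) ≤
          2 * max K 8 * dist (a (θ m)) ainf := by
        have := (hWlip (θ m)).dist_le_mul ((0 : ℝ), a (θ m)) ((0 : ℝ), ainf)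
        rw [Real.coe_toNNReal _ (by positivity), Prod.dist_eq, dist_self,
          max_eq_right dist_nonneg] at this
        exact this
      linarith [dist_triangle (W (θ m) (0, a (θ m))) (W (θ m) (0, ainf)) (Winf (0, ainf))]
    have h2 : Tendsto (fun m => 2 * max K 8 * dist (a (θ m)) ainf +
        dist (W (θ m) (0, ainf)) (Winf (0, ainf))) atTop (𝓝 0) := by
      have t1 := (tendsto_iff_dist_tendsto_zero.1 haconvθ).const_mul (2 * max K 8)
      have t2 := tendsto_iff_dist_tendsto_zero.1 (hWconvθ (0, ainf))
      simpa using t1.add t2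
    exact squeeze_zero (fun m => dist_nonneg) h1 h2
  have hnorm1 : ‖Winf (0, ainf)‖ = 1 := by
    have h1 : Tendsto (fun m => ‖W (θ m) (0, a (θ m))‖) atTop (𝓝 ‖Winf (0, ainf)‖) := hWa.norm
    have h2 : ∀ m, ‖W (θ m) (0, a (θ m))‖ = 1 := fun m => by
      show ‖V (θ m) (max (A (θ m) + 1) (min 0 0)) (a (θ m))‖ = 1
      rw [min_self, max_eq_right (by linarith [hA2' (θ m)])]
      exact hVone (θ m)
    refine tendsto_nhds_unique h1 ?_
    simp_rw [h2]
    exact tendsto_const_nhds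
  have hv0' : Winf (0, ainf) = 0 := hv0 0 le_rfl ainf
  rw [hv0', norm_zero] at hnorm1
  exact zero_ne_one hnorm1


end Literature.Analysis.FluidPDE
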